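import Summits.Langlands.Langlands.Theses.IrreducibilityBySelfDuality
import Summits.Langlands.Langlands.Theorems.IrreducibilityBySelfDualityReciprocityUpToIrreducibilityIsobaricRigidity
import Summits.Langlands.Langlands.Theorems.IrreducibilityBySelfDualityReciprocityUpToIrreducibilityDeRhamBlocks
import Summits.Langlands.Langlands.Theorems.IrreducibilityBySelfDualityReciprocityUpToIrreducibilityGeometricConstituents
import Literature.NumberTheory.Automorphic.IsAutomorphicAE
import Summits.Langlands.Langlands.Theorems.IrreducibilityBySelfDualityIrreducibleOffSectorOfReciprocity

/-!
# The decoupling of `ReciprocityUpToIrreducibility` (item stmt-Langlands-14328), line `Sketch`: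
# `E ⟸ W ∧ B_w ∧ LGC` modulo Arthur–Clozel (2.2)–(2.3) — the line's composition, in the tree

Support file (closes nothing).  Line `Sketch` (cards `isobaric-bootstrap`, `one-prime-companions`)
reduces the crux `E = ReciprocityUpToIrreducibility` to seven registered stubs; the three
THEOREM-grade ones are landed (`stub_isobaricRigidity` p105601 — conditional on the named facts
Arthur–Clozel (2.2) = route input `PairLBoundaryJS` and (2.3) = `JacquetShalika1981_partialPairL_pole_repData`
—, `stub_deRhamBlocks` p98936, `stub_geometricConstituents` p99702), `stub_jsPole` is the named fact
(2.3) itself, and the remaining three are the OPEN cores of `GL_n` reciprocity in their printed, datum-light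
shapes: **W** (weak existence — Buzzard–Gee Conj. 3.2.2 without irreducibility, uniqueness or
local–global compatibility), **B_w** (Fontaine–Mazur–Langlands in its a.e. form) and **LGC** (local–global
compatibility at every finite place for irreducible pairs; the only clause carrying `∃ Rec`).  This file
records the composition `reciprocityUpToIrreducibility_of_weak : (2.2) → (2.3) → W → B_w → LGC → E`
sorry-free in the tree, with W, B_w, LGC stated verbatim (the registered stub signatures) as hypotheses:
the crux is CLOSED MODULO {W, B_w, LGC, (2.2), (2.3)}.  The key step is the isobaric bootstrap run with
B_w: a pinned-geometric avatar of a cuspidal `π` is irreducible because its irreducible geometric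
constituents (P1 + D1) are cuspidal-automorphic by B_w and Jacquet–Shalika rigidity (K4) forbids `k ≥ 2`
of them.  (The by-products `Langlands ↔ E` and `E → IrreducibleOffSector` modulo (2.2)–(2.3) are already
in the tree from the sibling line on stmt-Langlands-14329:
`Summit.Langlands.Langlands.Theorems.IrreducibleOffSector.langlands_iff_reciprocityUpToIrreducibility_of_JS`,
`…IrreducibleOffSector_of_reciprocity`, p104397 — not duplicated here.)

No definitions; axioms `propext`, `Classical.choice`, `Quot.sound`.  The multiplicativity of the
Satake–Frobenius dictionary is reused from the sibling file (`IrreducibleOffSector.arithFrobPolyOfSatake_sum`).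
-/

noncomputable section

set_option linter.dupNamespace false -- project-wide option (lakefile weak.linter.dupNamespace); `Summit.Langlands.Langlands` is the mandated namespace

open scoped NumberField Classical Polynomial
open Filter IsDedekindDomain Polynomial
open Literature.NumberTheory.Automorphic Literature.NumberTheory.GaloisRepresentations
open Summit.Langlands
open Summit.Langlands.Langlands.Theses.IrreducibilityBySelfDuality

namespace Summit.Langlands.Langlands.Theorems.ReciprocityUpToIrreducibility

/-- **The decoupling of the item (composition of line `Sketch`), kernel-checked in the tree:**
`E ⟸ W ∧ B_w ∧ LGC` modulo Arthur–Clozel (2.2)–(2.3) — where W (weak existence: BG Conj. 3.2.2 without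
irreducibility, uniqueness or local–global compatibility), B_w (Fontaine–Mazur–Langlands in its a.e.
form) and LGC (local–global compatibility for irreducible pairs, the only clause carrying `∃ Rec`) are the
three OPEN registered stubs of the line, stated here verbatim as hypotheses.  Direction (A'): W gives a
pinned-geometric avatar, irreducible by the bootstrap (`isIrreducible_of_geometric_…` run with B_w in
place of `E`'s (B)), then LGC; direction (B): B_w then LGC.  No strong multiplicity one is used.
[folklore] -/
theorem reciprocityUpToIrreducibility_of_weak :
    JacquetShalika1981_partialPairL_boundary_repData →
    JacquetShalika1981_partialPairL_pole_repData →
    (∀ (K : Type) [Field K] [NumberField K] (n : ℕ) (hcpt : isCompact_glFiniteIntegralLevel n K),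
      0 < n → ∀ π : CuspidalAutomorphicRepData n K hcpt, π.1.IsLAlgebraic →
        ∀ (ℓ : ℕ) [Fact ℓ.Prime] (ι : PadicAlgCl ℓ ≃+* ℂ),
          ∃ ρ : FramedGaloisRep K (PadicAlgCl ℓ) n,
            ((∀ᶠ v : HeightOneSpectrum (𝓞 K) in cofinite, ρ.IsUnramifiedAt v) ∧
              ∀ (v : HeightOneSpectrum (𝓞 K)) (hv : ((ℓ : ℕ) : 𝓞 K) ∈ v.asIdeal),
                (Literature.NumberTheory.PAdicHodge.fontainePstAdicCompletion v ℓ hv).IsDeRhamFramed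
                  (ρ.toLocal v)) ∧
            ∀ᶠ v : HeightOneSpectrum (𝓞 K) in cofinite, SatakeFrobCompatibleAt ι π.1 ρ v) →
    (∀ (K : Type) [Field K] [NumberField K] (n : ℕ) (hcpt : isCompact_glFiniteIntegralLevel n K),
      0 < n → ∀ (ℓ : ℕ) [Fact ℓ.Prime] (ι : PadicAlgCl ℓ ≃+* ℂ) (ρ : FramedGaloisRep K (PadicAlgCl ℓ) n),
        ρ.toGaloisRep.IsIrreducible →
        ((∀ᶠ v : HeightOneSpectrum (𝓞 K) in cofinite, ρ.IsUnramifiedAt v) ∧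
          ∀ (v : HeightOneSpectrum (𝓞 K)) (hv : ((ℓ : ℕ) : 𝓞 K) ∈ v.asIdeal),
            (Literature.NumberTheory.PAdicHodge.fontainePstAdicCompletion v ℓ hv).IsDeRhamFramed
              (ρ.toLocal v)) →
          ∃ π : CuspidalAutomorphicRepData n K hcpt, π.1.IsLAlgebraic ∧
            ∀ᶠ v : HeightOneSpectrum (𝓞 K) in cofinite, SatakeFrobCompatibleAt ι π.1 ρ v) →
    (∀ (K : Type) [Field K] [NumberField K], ∃ Rec : ReciprocityData K,
      ∀ (n : ℕ) (hcpt : isCompact_glFiniteIntegralLevel n K), 0 < n →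
        ∀ (π : CuspidalAutomorphicRepData n K hcpt), π.1.IsLAlgebraic →
          ∀ (ℓ : ℕ) [Fact ℓ.Prime] (ι : PadicAlgCl ℓ ≃+* ℂ) (ρ : FramedGaloisRep K (PadicAlgCl ℓ) n),
            ρ.toGaloisRep.IsIrreducible →
            ((∀ᶠ v : HeightOneSpectrum (𝓞 K) in cofinite, ρ.IsUnramifiedAt v) ∧
              ∀ (v : HeightOneSpectrum (𝓞 K)) (hv : ((ℓ : ℕ) : 𝓞 K) ∈ v.asIdeal),
                (Literature.NumberTheory.PAdicHodge.fontainePstAdicCompletion v ℓ hv).IsDeRhamFramed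
                  (ρ.toLocal v)) →
              (∀ᶠ v : HeightOneSpectrum (𝓞 K) in cofinite, SatakeFrobCompatibleAt ι π.1 ρ v) →
                ∀ v : HeightOneSpectrum (𝓞 K), LocalGlobalCompatibleAt Rec ι π.1 ρ v) →
    ReciprocityUpToIrreducibility := by
  intro hJSb hJSp hW hB hL
  -- the bootstrap, run with B_w in place of `E`'s direction (B)
  have irr : ∀ (K : Type) [Field K] [NumberField K] (n : ℕ) (hcpt : isCompact_glFiniteIntegralLevel n K)
      (_ : 0 < n) (π : CuspidalAutomorphicRepData n K hcpt) (ℓ : ℕ) [Fact ℓ.Prime]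
      (ι : PadicAlgCl ℓ ≃+* ℂ) (ρ : FramedGaloisRep K (PadicAlgCl ℓ) n),
      ((∀ᶠ v : HeightOneSpectrum (𝓞 K) in cofinite, ρ.IsUnramifiedAt v) ∧
        ∀ (v : HeightOneSpectrum (𝓞 K)) (hv : ((ℓ : ℕ) : 𝓞 K) ∈ v.asIdeal),
          (Literature.NumberTheory.PAdicHodge.fontainePstAdicCompletion v ℓ hv).IsDeRhamFramed
            (ρ.toLocal v)) →
      (∀ᶠ v : HeightOneSpectrum (𝓞 K) in cofinite, SatakeFrobCompatibleAt ι π.1 ρ v) →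
        ρ.toGaloisRep.IsIrreducible := by
    intro K _ _ n hcpt hn π ℓ _ ι ρ hgeo hρ
    obtain ⟨k, m, r, hr, hchar, -, hone⟩ :=
      stub_geometricConstituents stub_deRhamBlocks K ℓ n ρ hn hgeo
    by_cases hk1 : k = 1
    · exact hone hk1
    have hk0 : k ≠ 0 := by
      rintro rfl
      have h1 := hchar 1
      simp only [Finset.univ_eq_empty, Finset.prod_empty] at h1
      have hdeg : (FramedRep.charpoly ρ 1).natDegree = n := by
        simp [FramedRep.charpoly, Matrix.charpoly_natDegree_eq_dim]
      rw [h1, natDegree_one] at hdeg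
      omega
    have hk2 : 2 ≤ k := by omega
    have hσ : ∀ i, ∃ σ : CuspidalAutomorphicRepData (m i) K
        (isCompact_glFiniteIntegralLevel_holds (m i) K),
        ∀ᶠ v : HeightOneSpectrum (𝓞 K) in cofinite, SatakeFrobCompatibleAt ι σ.1 (r i) v := by
      intro i
      obtain ⟨σ, -, hcorr⟩ := hB K (m i) (isCompact_glFiniteIntegralLevel_holds (m i) K) (hr i).1 ℓ ι
        (r i) (hr i).2.1 (hr i).2.2
      exact ⟨σ, hcorr⟩
    choose σ hσc using hσ
    refine (stub_isobaricRigidity hJSb hJSp K n hcpt π k m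
      (fun i => isCompact_glFiniteIntegralLevel_holds (m i) K) σ hn hk2 (fun i => (hr i).1) ?_).elim
    have hall : ∀ᶠ v : HeightOneSpectrum (𝓞 K) in cofinite,
        ∀ i, SatakeFrobCompatibleAt ι (σ i).1 (r i) v :=
      Filter.eventually_all.mpr hσc
    filter_upwards [hρ, hall] with v hv hvi
    intro α hα
    obtain ⟨α₀, hα₀, -, hcp⟩ := hv
    obtain rfl : α = α₀ := AutomorphicRepData.hasSatakeParamAt_unique_holds π.1 hα hα₀
    choose β hβ _hurβ hcpβ using hvi
    refine ⟨β, hβ, ?_⟩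
    have hprod : ρ.HasFrobCharpolyAt v (∏ i, arithFrobPolyOfSatake ι v.residueCard 1 (β i)) := by
      intro 𝔓 h𝔓 τ hτ
      rw [hchar τ]
      exact Finset.prod_congr rfl fun i _ => hcpβ i 𝔓 h𝔓 τ hτ
    rw [← Summit.Langlands.Langlands.Theorems.IrreducibleOffSector.arithFrobPolyOfSatake_sum] at hprod
    have heq : arithFrobPolyOfSatake ι v.residueCard 1 α =
        arithFrobPolyOfSatake ι v.residueCard 1 (∑ i, β i) :=
      GaloisRep.HasFrobCharpolyAt.unique_holds
        ((FramedGaloisRep.hasFrobCharpolyAt_toGaloisRep_iff v _ ρ).mpr hcp)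
        ((FramedGaloisRep.hasFrobCharpolyAt_toGaloisRep_iff v _ ρ).mpr hprod)
    exact arithFrobPolyOfSatake_one_injective ι _ heq
  intro F _ _
  obtain ⟨Rec, hRec⟩ := hL F
  refine ⟨Rec, fun n hn hcpt => ⟨fun π hLalg ℓ _ ι => ?_, fun ℓ _ ι ρ hirr hgeo => ?_⟩⟩
  · obtain ⟨ρ, hgeo, hρ⟩ := hW F n hcpt hn π hLalg ℓ ι
    have hirr : ρ.toGaloisRep.IsIrreducible := irr F n hcpt hn π ℓ ι ρ hgeo hρ
    exact ⟨ρ, hgeo, hρ, hRec n hcpt hn π hLalg ℓ ι ρ hirr hgeo hρ⟩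
  · obtain ⟨π, hLalg, hρ⟩ := hB F n hcpt hn ℓ ι ρ hirr hgeo
    exact ⟨π, hLalg, hρ, hRec n hcpt hn π hLalg ℓ ι ρ hirr hgeo hρ⟩

end Summit.Langlands.Langlands.Theorems.ReciprocityUpToIrreducibility

end
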